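import Summits.AnomalousDissipation.AnomalousDissipation.Theorems.SolenoidalFractalHomogenisationLagrangianStepCellChainFastSlaving
import Summits.AnomalousDissipation.AnomalousDissipation.Theorems.SolenoidalFractalHomogenisationLagrangianStepCellChainGapOfClassPair
import Summits.AnomalousDissipation.AnomalousDissipation.Theorems.SolenoidalFractalHomogenisationLagrangianStepSidebandXTailBound
import Summits.AnomalousDissipation.AnomalousDissipation.Theorems.SolenoidalFractalHomogenisationLagrangianStepSidebandXInitial
import Summits.AnomalousDissipation.AnomalousDissipation.Theorems.SolenoidalFractalHomogenisationLagrangianStepSidebandXEnergyExplicit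
import HarnessLib

/-!
# K1L_D `LagrangianRenormalisationStepDesign` (stmt-AnomalousDissipation-27980), `stub_D1_V0R` (ruling D27-1), brick T8b-2′a: POINTWISE
# SIDEBAND ENERGY — `Σ_{w∈S, w≠0}‖x(ℓ+n·w, t)‖² ≤ 64ξ²‖F‖²(Σ‖αⱼ‖)²/(π²lo²)` for the single-mode datum
# (helper; `--kind proof --supports stmt-AnomalousDissipation-27980 --as helper`)

Summits-side helper file of route `SolenoidalFractalHomogenisation` (prover seat `ad-k1l-cellLawV-w1` g7; 0 sorry, no defs, no named facts).
The time-INTEGRATED tail bound of `…SidebandXTailBound` carries no factor `ξ = |ℓ|/n` and therefore cannot feed the first-order averaging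
budget as `ξ → 0` (finding F-w1g7-2).  Here the tail is bounded POINTWISE in time, with the factor `ξ²`:
* §1 `ae_classPair_of_ne_zero_cell` — class-pair confinement of every weak solution along `W₁.cell n`
  (`PassiveVectorTensorSymmetry.ae_mFourierCoeff_eq_zero_off_sector`), and the gap `2π²·lo ≤ 8π²(lo/n²)|k|²` off `{±ℓ}` it yields;
* §2 **`sideband_energy_le`** (all sidebands, pointwise) — g5's fast-energy slaving `CellChain.fastEnergy_le_of_zero` at the block `{ℓ, −ℓ}`
  for the single-mode datum `Re e_ℓ·p`: every finite set of sideband modes `ℓ + n·w`, `w ≠ 0`, has energy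
  `≤ 64·ξ²·‖F‖²_{L²}·(Σⱼ‖αⱼ‖)²/(π²·lo²)` at every `t ∈ [0,T]`;
The shell and tail consequences (§3–§4: `shell_energy_le`, `tailEnergy_le_pointwise`) are in `…SidebandXShellEnergy`.
NOT a proof of any registered stub, of K1L_D, or of anomalous dissipation; rung F-D1.A0 infrastructure.
-/

set_option linter.dupNamespace false

noncomputable section

namespace Summit.AnomalousDissipation.AnomalousDissipation.Theorems.SolenoidalFractalHomogenisation.LagrangianStep.Sideband

open Set MeasureTheory Complex UnitAddTorus
open scoped InnerProductSpace
open Literature.Analysis Literature.Analysis.FunctionSpaces Literature.Analysis.FunctionSpaces.Torus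
open Literature.Analysis.FluidPDE Literature.Analysis.FluidPDE.Torus Literature.Analysis.FluidPDE.LatticeShear
open Summit.AnomalousDissipation.AnomalousDissipation.Theorems.SolenoidalFractalHomogenisation.LagrangianStep.CellChain
  (modeRep modeRep_zero continuousOn_modeRep hasDerivAt_norm_sq_modeRep linkCoeff norm_transversalProj_le fastEnergy_le_of_zero
   norm_sq_le_fastEnergy exists_energyRep_cell class_iff_dvd negClass_iff_dvd norm_latticeVec_ge_of_classPair_ne le_on_Icc_of_ae_le
   ae_forall_eq_modeRep)
open Summit.AnomalousDissipation.AnomalousDissipation.Theorems.SolenoidalFractalHomogenisation.RealisedQuasiStaticCellLaw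
  (singleMode_eq_realTrigPoly memLp_top_stLift_cell isWeaklyDivFree_singleMode memLp_two_of_memSobolev_one_complexify memSobolev_one_singleMode)
open Summit.AnomalousDissipation.AnomalousDissipation.Theorems.SolenoidalFractalHomogenisation.LagrangianStep
  (mFourierCoeff_singleMode_self cell_add_grid)

variable {k₀ : ℕ}

/-! ## §1 Class-pair confinement along `W₁.cell n` and the gap off `{±ℓ}` -/

/-- **Class-pair confinement** of every weak solution of the flat tensor cell problem along `W₁.cell n` (tensor `(1/n²)•𝔸`, `NearIso 𝔸 lo hi`,
`lo > 0`): if the `L²` datum is carried by the classes of `±ℓ`, so is `u t` for a.e. `t`. [cite: KhaKuchment2021, §1.1–§1.2 (G-periodic operators, γ_k-automorphic functions)] -/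
theorem ae_classPair_of_ne_zero_cell (W₁ : LatticeWord k₀) {n : ℕ} (hn : 0 < n) {𝔸 : Torus.Visc4 (Fin 3)} {lo hi : ℝ}
    (h𝔸 : Torus.NearIso 𝔸 lo hi) (hlo : 0 < lo) (ℓ : Fin 3 → ℤ) {F : UnitAddTorus (Fin 3) → EuclideanSpace ℝ (Fin 3)} (hF : MemLp F 2 volume)
    (hsupp : ∀ k, mFourierCoeff (FunctionSpaces.EuclideanSpace.complexify ∘ F) k ≠ 0 → (∀ i, (n : ℤ) ∣ k i - ℓ i) ∨ (∀ i, (n : ℤ) ∣ k i + ℓ i))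
    {T : ℝ} {u : ℝ → UnitAddTorus (Fin 3) → EuclideanSpace ℝ (Fin 3)}
    (hu : Torus.IsWeakTensorPassiveVectorOn 0 T ((1 / (n : ℝ) ^ 2) • 𝔸) (W₁.cell n) F u) :
    ∀ᵐ t ∂(volume.restrict (Ioo 0 T)), ∀ k, mFourierCoeff (FunctionSpaces.EuclideanSpace.complexify ∘ u t) k ≠ 0 →
      (∃ z : Fin 3 → ℤ, k = ℓ + (n : ℤ) • z) ∨ (∃ z : Fin 3 → ℤ, k = -ℓ + (n : ℤ) • z) := by
  have h𝔹 : Torus.NearIso ((1 / (n : ℝ) ^ 2) • 𝔸) (1 / (n : ℝ) ^ 2 * lo) (1 / (n : ℝ) ^ 2 * hi) := h𝔸.smul (by positivity)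
  have hn0 : (0:ℝ) < n := by exact_mod_cast hn
  have hlo' : 0 < 1 / (n : ℝ) ^ 2 * lo := by positivity
  filter_upwards [hu.ae_mFourierCoeff_eq_zero_off_sector hn ℓ h𝔹 hlo' (memLp_top_stLift_cell W₁ n T) (cell_add_grid W₁ hn) hF hsupp]
    with t ht k hk
  have hor : (∀ i, (n : ℤ) ∣ k i - ℓ i) ∨ (∀ i, (n : ℤ) ∣ k i + ℓ i) := by
    by_contra hcon
    exact hk (ht k hcon)
  exact hor.imp (class_iff_dvd n ℓ k).2 (negClass_iff_dvd n ℓ k).2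

/-- The single-mode datum `Re e_ℓ·p` is carried by `{ℓ, −ℓ}` (divisibility form). [folklore] -/
theorem singleMode_support_dvd (n : ℕ) (ℓ : Fin 3 → ℤ) (p : EuclideanSpace ℝ (Fin 3)) (k : Fin 3 → ℤ)
    (hk : mFourierCoeff (FunctionSpaces.EuclideanSpace.complexify ∘ fun x : UnitAddTorus (Fin 3) => (UnitAddTorus.mFourier ℓ x).re • p) k ≠ 0) :
    (∀ i, (n : ℤ) ∣ k i - ℓ i) ∨ (∀ i, (n : ℤ) ∣ k i + ℓ i) := by
  by_cases h1 : k = ℓ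
  · exact Or.inl fun i => by rw [h1, sub_self]; exact dvd_zero _
  by_cases h2 : k = -ℓ
  · exact Or.inr fun i => by rw [h2, Pi.neg_apply, neg_add_cancel]; exact dvd_zero _
  exact absurd (mFourierCoeff_singleMode_of_ne h1 h2 p) hk

/-- `‖linkCoeffⱼ(k, t)‖ ≤ 2π·√|k|²/n`. [cite: MeshalkinSinai1961, pp. 1700–1705] -/
theorem norm_linkCoeff_le_sqrt (W₁ : LatticeWord k₀) (n : ℕ) (k : Fin 3 → ℤ) (j : Fin k₀) (t : ℝ) :
    ‖linkCoeff W₁ n k j t‖ ≤ 2 * Real.pi * (Real.sqrt (freqNormSq k) / n) := by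
  simpa [classFreq_zero] using norm_linkCoeff_classFreq_le W₁ n k 0 j t

/-- `ℓ + n·w ≠ ℓ` for `w ≠ 0` (`n ≥ 1`). [folklore] -/
theorem classFreq_ne_self' {n : ℕ} (hn : n ≠ 0) (ℓ : Fin 3 → ℤ) {w : Fin 3 → ℤ} (hw : w ≠ 0) : classFreq n ℓ w ≠ ℓ := by
  intro h
  apply hw
  have h0 : classFreq n ℓ w = classFreq n ℓ 0 := by rw [h, classFreq_zero]
  exact classFreq_injective hn ℓ h0

/-- `ℓ + n·w ≠ −ℓ` for `w ≠ 0` when `2|ℓ| < n`. [cite: MajdaKramer1999, §2.2.1.3] -/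
theorem classFreq_ne_neg_self' {n : ℕ} {ℓ : Fin 3 → ℤ} (hℓ : 2 * Real.sqrt (freqNormSq ℓ) < n) {w : Fin 3 → ℤ} (hw : w ≠ 0) :
    classFreq n ℓ w ≠ -ℓ := by
  intro h
  have hi : ∀ i, (n : ℝ) * (w i : ℝ) = -2 * (ℓ i : ℝ) := by
    intro i
    have := congrFun h i
    simp only [classFreq_apply, Pi.neg_apply] at this
    have h' : (n : ℤ) * w i = -2 * ℓ i := by linarith
    exact_mod_cast h'
  have hsq : (n : ℝ) ^ 2 * freqNormSq w = 4 * freqNormSq ℓ := by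
    simp only [freqNormSq, Finset.mul_sum]
    refine Finset.sum_congr rfl fun i _ => ?_
    calc (n : ℝ) ^ 2 * ((w i : ℝ)) ^ 2 = ((n : ℝ) * (w i : ℝ)) ^ 2 := by ring
      _ = (-2 * (ℓ i : ℝ)) ^ 2 := by rw [hi i]
      _ = 4 * (ℓ i : ℝ) ^ 2 := by ring
  have hZ1 : 1 ≤ freqNormSq w := Torus.one_le_freqNormSq_of_ne_zero hw
  have hn : (0 : ℝ) ≤ n := Nat.cast_nonneg n
  have hsl : 0 ≤ Real.sqrt (freqNormSq ℓ) := Real.sqrt_nonneg _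
  have h2 : freqNormSq ℓ = Real.sqrt (freqNormSq ℓ) ^ 2 := (Real.sq_sqrt (freqNormSq_nonneg ℓ)).symm
  nlinarith [hsq, hZ1, h2, hℓ, mul_nonneg hn hsl]

/-- The chain neighbours `±ℓ ∓ n·mⱼ` of the slow pair lie outside `{ℓ, −ℓ}` (`2|ℓ| < n`, `mⱼ ≠ 0`). [cite: MajdaKramer1999, §2.2.1.3] -/
theorem pair_neighbours_not_mem (W₁ : LatticeWord k₀) {n : ℕ} (hn : n ≠ 0) {ℓ : Fin 3 → ℤ} (hℓ : 2 * Real.sqrt (freqNormSq ℓ) < n) :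
    ∀ k ∈ ({ℓ, -ℓ} : Finset (Fin 3 → ℤ)), ∀ j : Fin k₀,
      (k - fun i => (W₁.phase j).m i * n) ∉ ({ℓ, -ℓ} : Finset (Fin 3 → ℤ)) ∧
      (k + fun i => (W₁.phase j).m i * n) ∉ ({ℓ, -ℓ} : Finset (Fin 3 → ℤ)) := by
  have hm : ∀ j : Fin k₀, (W₁.phase j).m ≠ 0 := fun j => (W₁.phase j).m_ne
  have hmn : ∀ j : Fin k₀, -(W₁.phase j).m ≠ 0 := fun j => neg_ne_zero.2 (hm j)
  have hℓ' : 2 * Real.sqrt (freqNormSq (-ℓ)) < n := by rwa [freqNormSq_neg]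
  -- the four shifted vectors as class frequencies
  have e1 : ∀ (ℓ₀ : Fin 3 → ℤ) j, (ℓ₀ - fun i => (W₁.phase j).m i * n) = classFreq n ℓ₀ (-(W₁.phase j).m) := by
    intro ℓ₀ j; funext i; simp [classFreq_apply]; ring
  have e2 : ∀ (ℓ₀ : Fin 3 → ℤ) j, (ℓ₀ + fun i => (W₁.phase j).m i * n) = classFreq n ℓ₀ ((W₁.phase j).m) := by
    intro ℓ₀ j; funext i; simp [classFreq_apply]; ring
  intro k hk j
  simp only [Finset.mem_insert, Finset.mem_singleton] at hk ⊢
  rcases hk with rfl | rfl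
  · rw [e1, e2]
    exact ⟨not_or.2 ⟨classFreq_ne_self' hn _ (hmn j), classFreq_ne_neg_self' hℓ (hmn j)⟩,
      not_or.2 ⟨classFreq_ne_self' hn _ (hm j), classFreq_ne_neg_self' hℓ (hm j)⟩⟩
  · rw [e1, e2]
    refine ⟨not_or.2 ⟨?_, classFreq_ne_self' hn _ (hmn j)⟩, not_or.2 ⟨?_, classFreq_ne_self' hn _ (hm j)⟩⟩
    · have h1 := classFreq_ne_neg_self' (n := n) hℓ' (hmn j); rwa [neg_neg] at h1
    · have h1 := classFreq_ne_neg_self' (n := n) hℓ' (hm j); rwa [neg_neg] at h1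

/-! ## §2 All sidebands, pointwise: fast-energy slaving at the block `{ℓ, −ℓ}` -/

/-- **A finite set of modes off the block is below the fast energy, everywhere on `[0,T]`** (Parseval a.e. + continuity).
[cite: Grafakos2014, Prop. 3.2.7 (3)] -/
theorem sum_norm_sq_le_fastEnergy (W₁ : LatticeWord k₀) (n : ℕ) {T : ℝ} (hT : 0 < T) {𝔹 : Torus.Visc4 (Fin 3)}
    {F : UnitAddTorus (Fin 3) → EuclideanSpace ℝ (Fin 3)} {u : ℝ → UnitAddTorus (Fin 3) → EuclideanSpace ℝ (Fin 3)}
    (h : Torus.IsWeakTensorPassiveVectorOn 0 T 𝔹 (W₁.cell n) F u) (hF : Integrable F volume)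
    {E : ℝ → ℝ} (hEc : ContinuousOn E (Icc 0 T)) (hE : ∀ᵐ t ∂(volume.restrict (Ioo 0 T)), E t = ∫ x, ‖u t x‖ ^ 2)
    (W S : Finset (Fin 3 → ℤ)) (hSW : Disjoint S W) :
    ∀ t ∈ Icc 0 T, ∑ k ∈ S, ‖modeRep W₁ n 𝔹 F u k t‖ ^ 2 ≤ E t - ∑ k ∈ W, ‖modeRep W₁ n 𝔹 F u k t‖ ^ 2 := by
  classical
  have hcont : ∀ k, ContinuousOn (fun t => ‖modeRep W₁ n 𝔹 F u k t‖ ^ 2) (Icc 0 T) :=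
    fun k => ((continuousOn_modeRep W₁ n hT.le h k).norm).pow 2
  refine le_on_Icc_of_ae_le hT (continuousOn_finsetSum S fun k _ => hcont k) (hEc.sub (continuousOn_finsetSum W fun k _ => hcont k)) ?_
  filter_upwards [ae_forall_eq_modeRep W₁ n hT.le h hF, hE, h.ae_memLp_two] with t hrept hEt hmemt
  have hpars : HasSum (fun k => ‖modeRep W₁ n 𝔹 F u k t‖ ^ 2) (E t) := by
    have hp := hasSum_sq_norm_mFourierCoeff_complexify hmemt
    rw [hEt]
    refine hp.congr_fun fun k => ?_
    simp only [hrept k]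
  have h1 := sum_le_hasSum (S ∪ W) (fun i _ => sq_nonneg ‖modeRep W₁ n 𝔹 F u i t‖) hpars
  rw [Finset.sum_union hSW] at h1
  linarith

/-- **ALL SIDEBANDS, POINTWISE.**  For the single-mode datum `F = Re e_ℓ·p` (`p ⊥ ℓ`, `ℓ ≠ 0`, `2|ℓ| < n`), tensor `(1/n²)•𝔸` with `NearIso 𝔸 lo hi`,
`lo > 0`: every finite set `S` of nonzero class indices satisfies, at every `t ∈ [0,T]`,
`Σ_{w∈S} ‖x(ℓ + n·w, t)‖² ≤ 64·(√|ℓ|²/n)²·‖F‖²_{L²}·(Σⱼ‖αⱼ‖)²/(π²·lo²)` — fast-energy slaving at the block `{ℓ,−ℓ}` with gap `2π²lo` (class-pair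
confinement) and exchange amplitude `A = 8π ξ √‖F‖² Σⱼ‖αⱼ‖`. [cite: BedrossianCotiZelati2017, §2] [cite: Temam1984, Ch. III §1 Lemma 1.2] -/
theorem sideband_energy_le (W₁ : LatticeWord k₀) {n : ℕ} (hn : n ≠ 0) {T : ℝ} (hT : 0 < T) {𝔸 : Torus.Visc4 (Fin 3)} {lo hi : ℝ}
    (h𝔸 : Torus.NearIso 𝔸 lo hi) (hlo : 0 < lo) {ℓ : Fin 3 → ℤ} (hℓ0 : ℓ ≠ 0) (hℓ : 2 * Real.sqrt (freqNormSq ℓ) < n)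
    {p : EuclideanSpace ℝ (Fin 3)} (hp : ⟪p, Torus.latticeVec ℓ⟫_ℝ = 0) {u : ℝ → UnitAddTorus (Fin 3) → EuclideanSpace ℝ (Fin 3)}
    (h : Torus.IsWeakTensorPassiveVectorOn 0 T ((1 / (n : ℝ) ^ 2) • 𝔸) (W₁.cell n) (fun x => (UnitAddTorus.mFourier ℓ x).re • p) u)
    {t : ℝ} (ht : t ∈ Icc 0 T) (S : Finset (Fin 3 → ℤ)) (hS : ∀ w ∈ S, w ≠ 0) :
    ∑ w ∈ S, ‖modeRep W₁ n ((1 / (n : ℝ) ^ 2) • 𝔸) (fun x => (UnitAddTorus.mFourier ℓ x).re • p) u (classFreq n ℓ w) t‖ ^ 2 ≤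
      64 * (Real.sqrt (freqNormSq ℓ) / n) ^ 2 * (∫ x, ‖(UnitAddTorus.mFourier ℓ x).re • p‖ ^ 2) * (∑ j, ‖slotAmp W₁ j‖) ^ 2 /
        (Real.pi ^ 2 * lo ^ 2) := by
  classical
  set F : UnitAddTorus (Fin 3) → EuclideanSpace ℝ (Fin 3) := fun x => (UnitAddTorus.mFourier ℓ x).re • p with hFdef
  set 𝔹 := (1 / (n : ℝ) ^ 2) • 𝔸 with h𝔹def
  have hn0 : (0 : ℝ) < n := by exact_mod_cast Nat.pos_of_ne_zero hn
  have hnpos : 0 < n := Nat.pos_of_ne_zero hn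
  have h𝔹 : Torus.NearIso 𝔹 (1 / (n : ℝ) ^ 2 * lo) (1 / (n : ℝ) ^ 2 * hi) := h𝔸.smul (by positivity)
  have hlo' : 0 < 1 / (n : ℝ) ^ 2 * lo := by positivity
  have hF2 : MemLp F 2 volume := memLp_two_of_memSobolev_one_complexify (memSobolev_one_singleMode ℓ p)
  have hFi : Integrable F volume := hF2.integrable one_le_two
  have hFdiv : FunctionSpaces.Torus.IsWeaklyDivFree F := isWeaklyDivFree_singleMode ℓ hp
  obtain ⟨E, Q, hE0, -, hEc, hEanti, hEac, hEae, -, -, hEd, hQdom, -⟩ := exists_energyRep_cell W₁ n hT h𝔹 hlo' hF2 hFdiv h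
  have hne : ℓ ≠ -ℓ := fun h' => hℓ0 (by
    funext i; have hi := congrFun h' i; simp only [Pi.neg_apply] at hi; have : ℓ i = 0 := by omega
    simpa using this)
  set W : Finset (Fin 3 → ℤ) := {ℓ, -ℓ} with hW
  -- the gap off the block, from class-pair confinement
  have hℓn : 2 * ‖Torus.latticeVec ℓ‖ ≤ n := by
    have e : ‖Torus.latticeVec ℓ‖ = Real.sqrt (freqNormSq ℓ) := by
      rw [← norm_latticeVec_sq', Real.sqrt_sq (norm_nonneg _)]
    rw [e]; exact hℓ.le
  have hgap : ∀ᵐ s ∂(volume.restrict (Ioo 0 T)), ∀ k : Fin 3 → ℤ, k ∉ W →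
      mFourierCoeff (EuclideanSpace.complexify ∘ u s) k ≠ 0 → 2 * Real.pi ^ 2 * lo ≤ 8 * Real.pi ^ 2 * (1 / (n : ℝ) ^ 2 * lo) * freqNormSq k := by
    filter_upwards [ae_classPair_of_ne_zero_cell W₁ hnpos h𝔸 hlo ℓ hF2 (singleMode_support_dvd n ℓ p) h] with s hs k hkW hk
    have hmem := hs k hk
    rw [hW, Finset.mem_insert, Finset.mem_singleton, not_or] at hkW
    have hge := norm_latticeVec_ge_of_classPair_ne hmem hkW.1 hkW.2
    have hnn : 0 ≤ (n : ℝ) - ‖Torus.latticeVec ℓ‖ := by linarith [norm_nonneg (Torus.latticeVec ℓ)]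
    have hsq : ((n : ℝ) - ‖Torus.latticeVec ℓ‖) ^ 2 ≤ freqNormSq k := by
      rw [← norm_latticeVec_sq']; exact pow_le_pow_left₀ hnn hge 2
    have h4 : (n : ℝ) ^ 2 / 4 ≤ freqNormSq k := by nlinarith [norm_nonneg (Torus.latticeVec ℓ)]
    have e : 8 * Real.pi ^ 2 * (1 / (n : ℝ) ^ 2 * lo) * freqNormSq k = 8 * Real.pi ^ 2 * lo * (freqNormSq k / (n : ℝ) ^ 2) := by
      field_simp
    rw [e]
    have h4' : 1 / 4 ≤ freqNormSq k / (n : ℝ) ^ 2 := by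
      rw [le_div_iff₀ (by positivity)]; linarith
    nlinarith [Real.pi_pos, h4', mul_pos (mul_pos (by norm_num : (0:ℝ) < 8) (pow_pos Real.pi_pos 2)) hlo]
  have hdmin : 0 < 2 * Real.pi ^ 2 * lo := by positivity
  -- the exchange amplitude
  have hα : ∀ j : Fin k₀, ‖Complex.exp ((W₁.phase j).φ * Complex.I) * (1 / (2 * ((2 * Real.pi * ‖latticeVec (W₁.phase j).m‖ : ℝ) : ℂ) * Complex.I))‖ =
      ‖slotAmp W₁ j‖ := fun j => by rw [slotAmp_def]
  have hα' : ∀ j : Fin k₀, ‖starRingEnd ℂ (Complex.exp ((W₁.phase j).φ * Complex.I)) *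
      (-(1 / (2 * ((2 * Real.pi * ‖latticeVec (W₁.phase j).m‖ : ℝ) : ℂ) * Complex.I)))‖ = ‖slotAmp W₁ j‖ := fun j => by
    rw [← conj_slotAmp, Complex.norm_conj]
  have hxE : ∀ k, ∀ s ∈ Icc 0 T, ‖modeRep W₁ n 𝔹 F u k s‖ ≤ Real.sqrt (E 0) := by
    intro k s hs
    have h1 := norm_sq_le_fastEnergy W₁ n hT h hFi hEc hEae ∅ (Finset.notMem_empty k) s hs
    rw [Finset.sum_empty, sub_zero] at h1
    have h2 : E s ≤ E 0 := hEanti ⟨le_rfl, hT.le⟩ hs hs.1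
    rw [← Real.sqrt_sq (norm_nonneg (modeRep W₁ n 𝔹 F u k s))]
    exact Real.sqrt_le_sqrt (h1.trans h2)
  have hE0nn : 0 ≤ E 0 := by rw [hE0]; exact integral_nonneg fun x => sq_nonneg _
  set ξ := Real.sqrt (freqNormSq ℓ) / n with hξ
  have hξ0 : 0 ≤ ξ := by positivity
  set A : ℝ := 2 * (Real.sqrt (E 0) * ∑ j : Fin k₀, 2 * Real.pi * ξ * (‖slotAmp W₁ j‖ + ‖slotAmp W₁ j‖)) with hA
  have hlinkW : ∀ k ∈ W, ∀ j s, ‖linkCoeff W₁ n k j s‖ ≤ 2 * Real.pi * ξ := by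
    intro k hk j s
    rw [hW, Finset.mem_insert, Finset.mem_singleton] at hk
    rcases hk with rfl | rfl
    · exact norm_linkCoeff_le_sqrt W₁ n _ j s
    · have h1 := norm_linkCoeff_le_sqrt W₁ n (-ℓ) j s; rwa [freqNormSq_neg] at h1
  have hAb : ∀ s ∈ Icc 0 T, ∑ k ∈ W, (‖modeRep W₁ n 𝔹 F u k s‖ * ∑ j, ‖linkCoeff W₁ n k j s‖ *
      (‖Complex.exp ((W₁.phase j).φ * Complex.I) * (1 / (2 * ((2 * Real.pi * ‖latticeVec (W₁.phase j).m‖ : ℝ) : ℂ) * Complex.I))‖ +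
       ‖starRingEnd ℂ (Complex.exp ((W₁.phase j).φ * Complex.I)) *
          (-(1 / (2 * ((2 * Real.pi * ‖latticeVec (W₁.phase j).m‖ : ℝ) : ℂ) * Complex.I)))‖)) ≤ A := by
    intro s hs
    have hterm : ∀ k ∈ W, ‖modeRep W₁ n 𝔹 F u k s‖ * ∑ j, ‖linkCoeff W₁ n k j s‖ *
        (‖Complex.exp ((W₁.phase j).φ * Complex.I) * (1 / (2 * ((2 * Real.pi * ‖latticeVec (W₁.phase j).m‖ : ℝ) : ℂ) * Complex.I))‖ +
         ‖starRingEnd ℂ (Complex.exp ((W₁.phase j).φ * Complex.I)) *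
            (-(1 / (2 * ((2 * Real.pi * ‖latticeVec (W₁.phase j).m‖ : ℝ) : ℂ) * Complex.I)))‖) ≤
        Real.sqrt (E 0) * ∑ j : Fin k₀, 2 * Real.pi * ξ * (‖slotAmp W₁ j‖ + ‖slotAmp W₁ j‖) := by
      intro k hk
      refine mul_le_mul (hxE k s hs) (Finset.sum_le_sum fun j _ => ?_) (Finset.sum_nonneg fun j _ => by positivity) (Real.sqrt_nonneg _)
      rw [hα j, hα' j]
      exact mul_le_mul_of_nonneg_right (hlinkW k hk j s) (by positivity)
    calc _ ≤ ∑ _k ∈ W, Real.sqrt (E 0) * ∑ j : Fin k₀, 2 * Real.pi * ξ * (‖slotAmp W₁ j‖ + ‖slotAmp W₁ j‖) := Finset.sum_le_sum hterm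
      _ = A := by
          rw [Finset.sum_const, show W.card = 2 by rw [hW]; exact Finset.card_pair hne, two_nsmul, hA]; ring
  -- the datum is carried by the block: `E 0 = ‖x_ℓ(0)‖² + ‖x_{−ℓ}(0)‖²`
  have hcoefℓ : mFourierCoeff (FunctionSpaces.EuclideanSpace.complexify ∘ F) ℓ = (2 : ℂ)⁻¹ • FunctionSpaces.EuclideanSpace.complexify p :=
    mFourierCoeff_singleMode_self hℓ0 p
  have hcoefnℓ : mFourierCoeff (FunctionSpaces.EuclideanSpace.complexify ∘ F) (-ℓ) = (2 : ℂ)⁻¹ • FunctionSpaces.EuclideanSpace.complexify p := by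
    rw [hFdef, singleMode_eq_realTrigPoly, mFourierCoeff_realTrigPoly_singleton, if_neg (Ne.symm hne), if_pos rfl,
      FunctionSpaces.EuclideanSpace.conjVec_complexify, zero_add]
  have hkd : ∀ k ∈ W, kdot k (FunctionSpaces.EuclideanSpace.complexify p) = 0 := by
    intro k hk
    rw [hW, Finset.mem_insert, Finset.mem_singleton] at hk
    rcases hk with rfl | rfl
    · exact kdot_complexify_eq_zero hp
    · have h1 := kdot_complexify_eq_zero hp
      rw [kdot_apply] at h1 ⊢
      have e : ∑ j, (((-ℓ) j : ℤ) : ℂ) * FunctionSpaces.EuclideanSpace.complexify p j =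
          -∑ j, ((ℓ j : ℤ) : ℂ) * FunctionSpaces.EuclideanSpace.complexify p j := by
        rw [← Finset.sum_neg_distrib]; exact Finset.sum_congr rfl fun j _ => by simp
      rw [e, h1, neg_zero]
  have hmode0 : ∀ k ∈ W, modeRep W₁ n 𝔹 F u k 0 = mFourierCoeff (FunctionSpaces.EuclideanSpace.complexify ∘ F) k := by
    intro k hk
    have hc : mFourierCoeff (FunctionSpaces.EuclideanSpace.complexify ∘ F) k = (2 : ℂ)⁻¹ • FunctionSpaces.EuclideanSpace.complexify p := by
      rw [hW, Finset.mem_insert, Finset.mem_singleton] at hk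
      rcases hk with rfl | rfl
      · exact hcoefℓ
      · exact hcoefnℓ
    rw [modeRep_zero, hc, map_smul, transversalProj_eq_self_of_kdot_eq_zero k (hkd k hk)]
  have hZ0 : E 0 = ∑ k ∈ W, ‖modeRep W₁ n 𝔹 F u k 0‖ ^ 2 := by
    have hpars := hasSum_sq_norm_mFourierCoeff_complexify hF2
    have hfin : HasSum (fun k => ‖mFourierCoeff (EuclideanSpace.complexify ∘ F) k‖ ^ 2)
        (∑ k ∈ W, ‖mFourierCoeff (EuclideanSpace.complexify ∘ F) k‖ ^ 2) := by
      refine hasSum_sum_of_ne_finset_zero fun k hk => ?_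
      rw [hW, Finset.mem_insert, Finset.mem_singleton, not_or] at hk
      rw [hFdef, mFourierCoeff_singleMode_of_ne hk.1 hk.2 p, norm_zero, zero_pow two_ne_zero]
    rw [hE0, hpars.unique hfin]
    exact Finset.sum_congr rfl fun k hk => by rw [hmode0 k hk]
  -- fast-energy slaving
  have key := fastEnergy_le_of_zero W₁ n hT.le h𝔹 h hFi hEae hQdom hEd hEac W hdmin hgap (pair_neighbours_not_mem W₁ hn hℓ) hAb hZ0 ht
  -- the set `S` of sideband modes is off the block
  have hdisj : Disjoint (S.image (classFreq n ℓ)) W := by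
    rw [Finset.disjoint_left]
    intro k hk hkW
    obtain ⟨w, hw, rfl⟩ := Finset.mem_image.1 hk
    rw [hW, Finset.mem_insert, Finset.mem_singleton] at hkW
    rcases hkW with h1 | h2
    · exact classFreq_ne_self' hn ℓ (hS w hw) h1
    · exact classFreq_ne_neg_self' hℓ (hS w hw) h2
  have hB := sum_norm_sq_le_fastEnergy W₁ n hT h hFi hEc hEae W (S.image (classFreq n ℓ)) hdisj t ht
  rw [Finset.sum_image fun w _ w' _ hww' => classFreq_injective hn ℓ hww'] at hB
  refine (hB.trans key).trans (le_of_eq ?_)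
  have hA2 : A ^ 2 = 64 * Real.pi ^ 2 * ξ ^ 2 * E 0 * (∑ j, ‖slotAmp W₁ j‖) ^ 2 := by
    have hS : ∑ j : Fin k₀, 2 * Real.pi * ξ * (‖slotAmp W₁ j‖ + ‖slotAmp W₁ j‖) = 4 * Real.pi * ξ * ∑ j, ‖slotAmp W₁ j‖ := by
      rw [Finset.mul_sum]; exact Finset.sum_congr rfl fun j _ => by ring
    rw [hA, hS]
    have hsq : Real.sqrt (E 0) ^ 2 = E 0 := Real.sq_sqrt hE0nn
    calc (2 * (Real.sqrt (E 0) * (4 * Real.pi * ξ * ∑ j, ‖slotAmp W₁ j‖))) ^ 2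
        = 64 * Real.pi ^ 2 * ξ ^ 2 * Real.sqrt (E 0) ^ 2 * (∑ j, ‖slotAmp W₁ j‖) ^ 2 := by ring
      _ = _ := by rw [hsq]
  rw [hA2, hE0]
  field_simp
  ring

end Summit.AnomalousDissipation.AnomalousDissipation.Theorems.SolenoidalFractalHomogenisation.LagrangianStep.Sideband

end
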